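import Summits.BirchSwinnertonDyer.BirchSwinnertonDyer.Theorems.TwoAdicConverseBDPSelmerLowerDivisibilityAtTwoPairTransportXGr
import Literature.NumberTheory.EllipticCurves.ZpExtensionPairTowerUniversalProofs
import Literature.NumberTheory.EllipticCurves.HeegnerPoints
import HarnessLib

/-!
# Pair transport for two-variable Iwasawa duals, V: O2 piece P3 (PAIR-TRANSPORT₂) `TorsionResidueTransportAt W K` is a
# KERNEL THEOREM — unconditionally, for every `W/ℚ` and every imaginary quadratic `K` (indeed every `K` with `[K:ℚ] ≤ 2`)

Cell `bsd-2adic`, seat `bsd-2adic-tower-1` GEN 49, SUMMON key «PAIR-TRANSPORT₂» (pen `bsd-2adic-plan` g35; director-bsd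
(552)(C)(W1), (556)(C)(ii)): piece P3 `SplitPrimeLineFiniteTwo.TorsionResidueTransportAt W K` of the O2 node
(stmt-BirchSwinnertonDyer-24728 `BDPSelmerLowerDivisibilityAtTwo`, line of record v7, registered stub
`stub_torsionResidueTransport : ∀ W K, TorsionResidueTransportAt W K`).  Helper file (`--supports 24728`); closes
nothing; BSD is proved for no curve; typed ≠ proved.

WHAT IS PROVED in the prequels (files I–IV, kernel, unconditional; any number field `K`, any prime `p`, any `W/K`): for two
topological generator pairs `(κ₁, κ₂; γ₁, γ₂)`, `(κ₁', κ₂'; γ₁', γ₂')` of `ℤ_p`-extensions of `K` that cut out THE SAME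
tower, `pairKer κ₁ κ₂ = pairKer κ₁' κ₂'` (`= Gal(K̄/K̃_∞)`):

* `xGr₂_pair_smul_eq` — on `X_Gr₂ = W.XGr₂ p κ₁ κ₂ v̄ γ₁ γ₂` the `Λ₂`-action through `(conj_{γ₁'} − 1, conj_{γ₂'} − 1)` is the
  tree's action (`instModuleXGr₂`, through `(γ₁, γ₂)`) pulled back along the frame substitution
  `φ = IwasawaAlgebra₂.frameSubstRingHom ℤ_p (κ_i(γ_j'))_{ij}` (files II–IV);
* `isTorsion_xGr₂_of_pairKer_eq` — `X_Gr₂` for the primed pair `Λ₂`-torsion ⟹ `X_Gr₂` for the unprimed pair `Λ₂`-torsion;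
* `charIdeal_xGr₂_eq_map_of_pairKer_eq` — `ch(X_Gr₂) = φ(ch(X_Gr₂'))` (tree `Module.charIdeal_eq_map_of_semilinearEquiv`,
  `φ ∈ Aut(Λ₂)` by `pairMatrix_mul_pairMatrix`);
* `map_residue_toUnr₂_ne_zero_of_pairKer_eq` — residual non-vanishing of characteristic generators passes from the primed
  to the unprimed pair (`red(toUnr₂ J C₀) ≠ 0 ⟺ p ∤ C₀`, and `φ` fixes constants).

The comparison needs NO new object: `XGr₂` is defined pair-by-pair as `Hom(unrSelmer₂ κ₁ κ₂ E[p^∞] v̄, ℚ/ℤ)`, a type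
depending on `(κ₁, κ₂)` only through the subgroup `pairKer κ₁ κ₂`; along `pairKer κ₁ κ₂ = pairKer κ₁' κ₂'` the two
types and their `conj`-operators are literally the same (a `subst` over a variable subgroup, file IV), and the two
`Λ₂`-structures on the common group differ by `φ` (files I–III).

WHAT CLOSES THE GAP (THIS FILE): as TYPED, P3 quantifies over two UNRELATED generator pairs of `K`; that they cut out the same
tower — «the `ℤ_p`-rank of an imaginary quadratic field is `2`», Lang *Cyclotomic Fields I–II* Ch. 5 §5 Thm. 5.2 = Washington
Thm. 13.4 — is ALREADY A SORRY-FREE THEOREM OF THE TREE in presented form: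
`ZpExtension.IsTopGeneratorPair.pairKer_eq_pairKer (hK : Module.finrank ℚ K ≤ 2) (h) (h') : pairKer κ₁ κ₂ = pairKer κ₁' κ₂'`
(`Literature/…/ZpExtensionPairTowerUniversalProofs.lean`, on `kerSubgroup_inf_le_kerSubgroup_of_surjective` of
`IwasawaZpRankUpperBoundProofs.lean` — the unconditional upper bound `rank_{ℤ_p} ≤ [K:ℚ]`).  Hence §1
`torsionResidueTransportAt_two`: P3's body VERBATIM, with NO named-fact hypothesis — the v7 stub closes by
`fun W _ K _ _ ↦ torsionResidueTransportAt_two W K`; and `torsionResidueTransportAt_two_of_pairKer_eq` (any number field `K`,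
two pairs with the same `pairKer`).  No new definition, no named fact (D-0026: net debt 0).

References: S. Lang, *Cyclotomic Fields I–II*, GTM 121 (1990), Ch. 5 §5 Thm. 5.2, Ch. 5 §1 [Lang1990]; L. Washington,
*Introduction to Cyclotomic Fields*, Thm. 13.4, §13.2 [Washington1997]; Neukirch–Schmidt–Wingberg (5.3.5)
[NeukirchSchmidtWingberg2008]; N. Bourbaki, AC VII §4.5 [BourbakiAC5to7]; K. Rubin, Invent. Math. 103 (1991) §4 p. 36
[Rubin1991]; Burungale–Castella–Skinner, arXiv:2405.00270v2 §2.1, Conj. 4.1.2 [BurungaleCastellaSkinner2025].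
-/

noncomputable section

set_option linter.dupNamespace false
set_option autoImplicit false

open scoped Classical
open NumberField IsDedekindDomain Field PowerSeries
open Literature.NumberTheory.GaloisRepresentations
open Literature.NumberTheory.EllipticCurves Literature.NumberTheory.EllipticCurves.IwasawaDual
  Literature.NumberTheory.EllipticCurves.TwoVariableSelmer Literature.NumberTheory.EllipticCurves.GreenbergSelmer
  Literature.NumberTheory.EllipticCurves.GreenbergVatsal2000 Literature.NumberTheory.EllipticCurves.Castella2018

universe u

namespace Summit.BirchSwinnertonDyer.BirchSwinnertonDyer.Theorems.TwoAdicBDPPairTransport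

/-! ## §1 P3 of the O2 node: `TorsionResidueTransportAt W K`, unconditionally -/

/-- **PAIR-TRANSPORT₂ (O2 piece P3), a kernel theorem.**  For `W/ℚ`, `K` imaginary quadratic and a prime `v̄ ∣ 2` of `K`: for
ANY two adapted pairs `(κ₁, κ₂; γ₁, γ₂)`, `(κ₁', κ₂'; γ₁', γ₂')` of `ℤ₂`-extensions of `K`, `Λ₂`-torsion of `X_Gr₂((E_K)/K̃_∞)` and the
residual non-vanishing `red(toUnr₂ J C₀) ≠ 0` of the generators of its characteristic ideal pass from the primed to the unprimed pair
— VERBATIM the body of seat 2's `SplitPrimeLineFiniteTwo.TorsionResidueTransportAt W K` (v7 stub `stub_torsionResidueTransport` of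
stmt-BirchSwinnertonDyer-24728).  The two pairs cut out the same tower by the tree's
`ZpExtension.IsTopGeneratorPair.pairKer_eq_pairKer` (`[K:ℚ] ≤ 2`; Washington Thm. 13.4 in presented form), and files I–IV do
the transport.  Closes nothing by itself; BSD is proved for no curve. [cite: Washington1997, §13.1 Thm. 13.4]
[cite: BurungaleCastellaSkinner2025, Conj. 4.1.2 (p. 8 of arXiv:2405.00270v2)] -/
theorem torsionResidueTransportAt_two (W : WeierstrassCurve ℚ) [W.IsElliptic] (K : Type) [Field K] [NumberField K] :
    IsImaginaryQuadratic K → ∀ (vbar : HeightOneSpectrum (𝓞 K)), ((2 : ℕ) : 𝓞 K) ∈ vbar.asIdeal →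
    ∀ (κ₁ κ₂ κ₁' κ₂' : ZpExtension K 2) (γ₁ γ₂ γ₁' γ₂' : Field.absoluteGaloisGroup K)
      [Fact (ZpExtension.IsTopGeneratorPair κ₁ κ₂ γ₁ γ₂)] [Fact (ZpExtension.IsTopGeneratorPair κ₁' κ₂' γ₁' γ₂')],
      (Module.IsTorsion (IwasawaAlgebra₂ 2) ((W.baseChange K).XGr₂ 2 κ₁' κ₂' vbar γ₁' γ₂') →
          Module.IsTorsion (IwasawaAlgebra₂ 2) ((W.baseChange K).XGr₂ 2 κ₁ κ₂ vbar γ₁ γ₂)) ∧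
        ((∀ (J : ℤ_[2] →+* PadicComplexInt 2) (C₀ : IwasawaAlgebra₂ 2),
            WeierstrassCurve.XGr₂.charIdeal (W.baseChange K) 2 κ₁' κ₂' vbar γ₁' γ₂' = Ideal.span {C₀} →
              PowerSeries.map (PowerSeries.map (IsLocalRing.residue (PadicComplexInt 2)))
                (IwasawaAlgebra₂.toUnr₂ 2 J C₀) ≠ 0) →
          ∀ (J : ℤ_[2] →+* PadicComplexInt 2) (C₀ : IwasawaAlgebra₂ 2),
            WeierstrassCurve.XGr₂.charIdeal (W.baseChange K) 2 κ₁ κ₂ vbar γ₁ γ₂ = Ideal.span {C₀} →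
              PowerSeries.map (PowerSeries.map (IsLocalRing.residue (PadicComplexInt 2)))
                (IwasawaAlgebra₂.toUnr₂ 2 J C₀) ≠ 0) := by
  intro hK vbar _ κ₁ κ₂ κ₁' κ₂' γ₁ γ₂ γ₁' γ₂' hγ hγ'
  have hH : ZpExtension.pairKer κ₁ κ₂ = ZpExtension.pairKer κ₁' κ₂' :=
    ZpExtension.IsTopGeneratorPair.pairKer_eq_pairKer hK.1.le hγ.out hγ'.out
  exact ⟨isTorsion_xGr₂_of_pairKer_eq (W.baseChange K) 2 κ₁ κ₂ κ₁' κ₂' vbar γ₁ γ₂ γ₁' γ₂' hH,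
    map_residue_toUnr₂_ne_zero_of_pairKer_eq (W.baseChange K) 2 κ₁ κ₂ κ₁' κ₂' vbar γ₁ γ₂ γ₁' γ₂' hH⟩

/-- **The same transport for ANY number field `K` and two pairs KNOWN to cut out the same tower** (`pairKer κ₁ κ₂ = pairKer κ₁' κ₂'`,
`p = 2`).
[cite: BurungaleCastellaSkinner2025, Conj. 4.1.2 (p. 8 of arXiv:2405.00270v2)] [cite: NeukirchSchmidtWingberg2008, (5.3.5)] -/
theorem torsionResidueTransportAt_two_of_pairKer_eq (W : WeierstrassCurve ℚ) [W.IsElliptic] (K : Type) [Field K]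
    [NumberField K] (vbar : HeightOneSpectrum (𝓞 K)) (κ₁ κ₂ κ₁' κ₂' : ZpExtension K 2)
    (γ₁ γ₂ γ₁' γ₂' : Field.absoluteGaloisGroup K) [Fact (ZpExtension.IsTopGeneratorPair κ₁ κ₂ γ₁ γ₂)]
    [Fact (ZpExtension.IsTopGeneratorPair κ₁' κ₂' γ₁' γ₂')] (hH : ZpExtension.pairKer κ₁ κ₂ = ZpExtension.pairKer κ₁' κ₂') :
    (Module.IsTorsion (IwasawaAlgebra₂ 2) ((W.baseChange K).XGr₂ 2 κ₁' κ₂' vbar γ₁' γ₂') →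
        Module.IsTorsion (IwasawaAlgebra₂ 2) ((W.baseChange K).XGr₂ 2 κ₁ κ₂ vbar γ₁ γ₂)) ∧
      ((∀ (J : ℤ_[2] →+* PadicComplexInt 2) (C₀ : IwasawaAlgebra₂ 2),
          WeierstrassCurve.XGr₂.charIdeal (W.baseChange K) 2 κ₁' κ₂' vbar γ₁' γ₂' = Ideal.span {C₀} →
            PowerSeries.map (PowerSeries.map (IsLocalRing.residue (PadicComplexInt 2)))
              (IwasawaAlgebra₂.toUnr₂ 2 J C₀) ≠ 0) →
        ∀ (J : ℤ_[2] →+* PadicComplexInt 2) (C₀ : IwasawaAlgebra₂ 2),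
          WeierstrassCurve.XGr₂.charIdeal (W.baseChange K) 2 κ₁ κ₂ vbar γ₁ γ₂ = Ideal.span {C₀} →
            PowerSeries.map (PowerSeries.map (IsLocalRing.residue (PadicComplexInt 2)))
              (IwasawaAlgebra₂.toUnr₂ 2 J C₀) ≠ 0) :=
  ⟨isTorsion_xGr₂_of_pairKer_eq (W.baseChange K) 2 κ₁ κ₂ κ₁' κ₂' vbar γ₁ γ₂ γ₁' γ₂' hH,
    map_residue_toUnr₂_ne_zero_of_pairKer_eq (W.baseChange K) 2 κ₁ κ₂ κ₁' κ₂' vbar γ₁ γ₂ γ₁' γ₂' hH⟩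

end Summit.BirchSwinnertonDyer.BirchSwinnertonDyer.Theorems.TwoAdicBDPPairTransport

end
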